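import Mathlib
import Summits.QuantumFields.BalabanUV.Beta.GAN24.MonotoneCoarsen

/-!
# Beta / GaugeSliceLegitimacy — SLICE LEGITIMACY `K ≤ K ⊓ ker G ⊔ T` from «the slice rows are injective on the gauge motions» plus a
# row count: the finite-dimensional supplier of the hypothesis `hKST` of gan24-p4's `GAN24/MonotoneCoarsen` §4 `isCrit_of_slice`
# (β-PERT asymptotic lane asym1, unit `b2b-balaban-beta-asym1` GEN 20, journal CLAIM «ASYM1-g20-LEGIT»; consumer: BINDER-OWNERS row G-an2-4 ∕
# (CONV-C), road P4 «rate OR monotonicity», SKELETON-P4 v1.1 node N4 ∕ M4 UPGRADE; asked for by gan24-p4-g2, journal l.3146 (B))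

HONEST FRAMING (page 1 of everything the β sub-cell writes): discharging `BetaPertH` makes Bałaban's UV stability UNCONDITIONAL — a
real constructive-QFT result; it is NOT the continuum limit and NOT the Clay problem.  HONEST DEPENDENCY (cell reorg 2026-08-19, verbatim):
«continuum YM on T⁴ ⇐ BetaPertH ∧ nine spine estimates (0/9 proved); BetaPertH ⇐ (D1) ∧ (D4) ∧ CAP+tail; G-an2-4 gates asym, D1 and NE2/3/4.»
0 of `FlowStep.BetaPertH` discharged here; 0 wall binders instantiated; k₀ none.  This module is [folklore] finite-dimensional linear algebra:
it contains no estimate, no rate, nothing of (CONV-C), no `def … : Prop` fact, and cites nothing.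

ABSOLUTE RULE (cell charter, verbatim): "No internally-minted statement may enter as a cited fact. Every hypothesis is either
kernel-proved in this package or a verbatim quotation of a PUBLISHED theorem with page reference. The manuscript(s) under audit are
NOT citable for their own disputed steps — they are the thing under adjudication; programme-internal (2001/route/tribunal) claims
are never citable."  Nothing below is cited; everything is proved.

## WHY
gan24-p4's `MonotoneCoarsen.pairing_coarsen_le` makes the decimated one-step covariance Loewner-DECREASE along Bałaban's averaging on every
source `r` for which the KKT column is CRITICAL ON THE GAUGE-FREE constraint space `K = ker 𝒬_{N′}`; its §4 `isCrit_of_slice` (v1.1) transfers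
criticality from the typed slice `K ⊓ S` (`S = ker G`, the G-rows of an5's `KKTFluctuationUnique.SolvesKKT`: `δdδA` block-constant) to `K`
for sources invariant under the RESIDUAL gauge motions `T = {dλ : Bs_{N′} λ = const}` — exactly the sources with block-constant divergence
(asym1-g19 MONOTRANS (C): `Π_bm (K_{j+1} − K_j) Π_bmᵀ ⪯ 0` from step 0 in every toy case) — under ONE structural hypothesis,
SLICE LEGITIMACY `hKST : K ≤ K ⊓ S ⊔ T` («every constrained field can be brought into the slice by a residual gauge motion»).
THIS FILE reduces `hKST` to two finite checks per (torus ∕ Bloch fibre): (i) `Disjoint T (ker G)` — no non-zero gauge motion satisfies the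
slice rows — which for an5's rows is the energy identity `⟨λ, Δ₀²λ⟩ = ‖Δ₀λ‖² = ⟨Bs λ, c⟩ = 0` (§3 `mulVec_eq_zero_of_mulVec_mulVec_eq`), and
(ii) a ROW COUNT `#rows ≤ dim T` (both `= N′^D − 1` per block: the G-rows are indexed by the non-base points of a block, the residual gauge
functions are the functions modulo one constant per block).  (i) + (ii) ⟹ the slice rows map `T` ONTO the row space (§2), hence `hKST` (§1).

## WHAT IS PROVED ([folklore]; `𝕜` any field; §3 over a star-ordered field as in `MonotoneCoarsen`)
* §1 `le_inf_ker_sup_iff_map_le`: for `T ≤ K`, `K ≤ K ⊓ ker G ⊔ T ↔ K.map G ≤ T.map G` (legitimacy is a statement about IMAGES of the slice rows);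
  `le_inf_ker_sup_of_map_eq_top` (rows onto ⟹ legitimate).
* §2 `map_eq_top_of_disjoint_ker`: `Disjoint T (ker G)` and `finrank W ≤ finrank T` ⟹ `T.map G = ⊤`; **`le_inf_ker_sup_of_disjoint_ker`** =
  (i) + (ii) + `T ≤ K` ⟹ `K ≤ K ⊓ ker G ⊔ T`; matrix currency **`le_inf_ker_sup_of_disjoint_ker_mulVecLin`** (`G : Matrix m n 𝕜`, rows counted by
  `Fintype.card m`, subspaces of `n → 𝕜` as in `MonotoneCoarsen.IsCrit`).
* §3 `mulVec_eq_zero_of_mulVec_mulVec_eq`: `Δ` Hermitian, `Bs λ = 0`, `Δ (Δ λ) = Bsᴴ c` ⟹ `Δ λ = 0` (the injectivity socket (i) in the shape the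
  torus and every Bloch fibre use it: `Δ = Δ₀`, `Bs` = block sums; then `dλ = 0` by the kernel of `Δ₀` on the relevant class — constants resp. `0`).
* §4 **`sliceMultiplier_eq_zero`** (what legitimacy BUYS, one line stronger than criticality-transfer): `H` Hermitian with `H t = 0` and `Q t = 0` on
  `T`, source `r ⊥ T`, KKT row `H v − r = Qᴴ φ + Gᴴ ν`, and `G(T) = ⊤` ⟹ the slice multiplier `ν = 0`; `gaugeFree_kkt_of_legit`: hence
  `H v − r = Qᴴ φ`, so `MonotoneCoarsen.isCrit_ker_of_kkt` yields `IsCrit H r (ker Q) v` with no further hypothesis (the asym1-g20 diagnostic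
  `gauge_torus.py` sees exactly this: the gauge-multiplier term of the typed ∕ block-Landau ∕ block-axial columns is `≤ 1.5·10⁻¹¹` of its generic
  size on every source with block-constant divergence, D = 2, Lc = 2,3,4 — markdown only, not load-bearing).
* §5 (imports `GAN24/MonotoneCoarsen`) `sliceMultiplier_eq_zero_of_disjoint_ker`: KKT row + `T ≤ ker Q`, `H T = 0`, `r ⊥ T` + (i) + (ii) ⟹ `ν = 0`;
  **`isCrit_ker_of_kkt₂_of_disjoint_ker`**: + `Q v = 0` ⟹ `IsCrit H r (ker Q) v` (via `isCrit_ker_of_kkt`; = `isCrit_of_slice` (v1.1 p202767) ∘ `isCrit_inf_of_kkt₂` ∘ §2).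
NOT HERE (owned elsewhere, by name): `isCrit_of_slice` itself (gan24-p4 `MonotoneCoarsen` v1.1 p202767, USED not restated); the instantiation on an2's Bloch fibres
(SKELETON-P4 N4; needs the swarm's fibrewise `Hfib ∕ Qrow ∕ Grow` objects); the torus objects of the diagnostic numerics (markdown only).
-/

namespace Summit.QuantumFields.BalabanUV.Beta.GaugeSliceLegitimacy

open Matrix

/-! ## §1 Legitimacy is a statement about the images of the slice rows -/

section Images

variable {𝕜 : Type*} [Field 𝕜] {V W : Type*} [AddCommGroup V] [Module 𝕜 V] [AddCommGroup W] [Module 𝕜 W]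

/-- **SLICE LEGITIMACY ⟺ IMAGE CONDITION.**  For gauge motions `T` inside the constraint space `K` and slice rows `G`:
`K ≤ K ⊓ ker G ⊔ T` (every `w ∈ K` is `s + t` with `s` in the slice and `t` a gauge motion) iff `G(K) ⊆ G(T)` (the rows of every constrained
field are the rows of some gauge motion). [folklore] -/
theorem le_inf_ker_sup_iff_map_le (G : V →ₗ[𝕜] W) {K T : Submodule 𝕜 V} (hTK : T ≤ K) :
    K ≤ K ⊓ LinearMap.ker G ⊔ T ↔ K.map G ≤ T.map G := by
  constructor
  · intro h x hx
    obtain ⟨w, hw, rfl⟩ := Submodule.mem_map.1 hx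
    obtain ⟨s, hs, t, ht, hst⟩ := Submodule.mem_sup.1 (h hw)
    have hGs : G s = 0 := LinearMap.mem_ker.1 (Submodule.mem_inf.1 hs).2
    refine Submodule.mem_map.2 ⟨t, ht, ?_⟩
    rw [← hst, map_add, hGs, zero_add]
  · intro h w hw
    obtain ⟨t, ht, hGt⟩ := Submodule.mem_map.1 (h (Submodule.mem_map_of_mem hw))
    have hs : w - t ∈ K ⊓ LinearMap.ker G :=
      Submodule.mem_inf.2 ⟨K.sub_mem hw (hTK ht), by simp [LinearMap.mem_ker, map_sub, hGt]⟩
    simpa using Submodule.add_mem_sup hs ht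

/-- Rows ONTO ⟹ legitimate. [folklore] -/
theorem le_inf_ker_sup_of_map_eq_top (G : V →ₗ[𝕜] W) {K T : Submodule 𝕜 V} (hTK : T ≤ K) (htop : T.map G = ⊤) :
    K ≤ K ⊓ LinearMap.ker G ⊔ T :=
  (le_inf_ker_sup_iff_map_le G hTK).2 (htop ▸ le_top)

end Images

/-! ## §2 Injective on the gauge motions + row count ⟹ onto ⟹ legitimate -/

section Count

variable {𝕜 : Type*} [Field 𝕜] {V W : Type*} [AddCommGroup V] [Module 𝕜 V] [AddCommGroup W] [Module 𝕜 W]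

/-- **(i) + (ii) ⟹ ONTO.**  If no non-zero gauge motion satisfies the slice rows (`Disjoint T (ker G)`) and there are at most `dim T` rows
(`finrank W ≤ finrank T`), the rows map the gauge motions onto the whole row space. [folklore] -/
theorem map_eq_top_of_disjoint_ker [FiniteDimensional 𝕜 W] (G : V →ₗ[𝕜] W) {T : Submodule 𝕜 V} [FiniteDimensional 𝕜 T]
    (hdis : Disjoint T (LinearMap.ker G)) (hdim : Module.finrank 𝕜 W ≤ Module.finrank 𝕜 T) : T.map G = ⊤ := by
  have hrange : T.map G = LinearMap.range (G.comp T.subtype) := by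
    rw [LinearMap.range_comp, Submodule.range_subtype]
  have hinj : Function.Injective (G.comp T.subtype) := by
    rw [← LinearMap.ker_eq_bot, LinearMap.ker_comp, ← Submodule.disjoint_iff_comap_eq_bot]
    exact hdis
  have hfr : Module.finrank 𝕜 (T.map G) = Module.finrank 𝕜 T := by
    rw [hrange]; exact LinearMap.finrank_range_of_inj hinj
  exact Submodule.eq_top_of_finrank_eq (le_antisymm (Submodule.finrank_le _) (by rw [hfr]; exact hdim))

/-- **SLICE LEGITIMACY FROM (i) + (ii)** — the supplier of `MonotoneCoarsen.isCrit_of_slice`'s `hKST`: gauge motions inside the constraint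
space, injectivity of the slice rows on them, and the row count give `K ≤ K ⊓ ker G ⊔ T`. [folklore] -/
theorem le_inf_ker_sup_of_disjoint_ker [FiniteDimensional 𝕜 W] (G : V →ₗ[𝕜] W) {K T : Submodule 𝕜 V} [FiniteDimensional 𝕜 T]
    (hTK : T ≤ K) (hdis : Disjoint T (LinearMap.ker G)) (hdim : Module.finrank 𝕜 W ≤ Module.finrank 𝕜 T) :
    K ≤ K ⊓ LinearMap.ker G ⊔ T :=
  le_inf_ker_sup_of_map_eq_top G hTK (map_eq_top_of_disjoint_ker G hdis hdim)

variable {m n : Type*} [Fintype m] [Fintype n]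

/-- The same in the MATRIX currency of `MonotoneCoarsen` (`G : Matrix m n 𝕜` the slice rows, subspaces of `n → 𝕜`, rows counted by
`Fintype.card m`). [folklore] -/
theorem le_inf_ker_sup_of_disjoint_ker_mulVecLin (G : Matrix m n 𝕜) {K T : Submodule 𝕜 (n → 𝕜)} (hTK : T ≤ K)
    (hdis : Disjoint T (LinearMap.ker G.mulVecLin)) (hdim : Fintype.card m ≤ Module.finrank 𝕜 T) :
    K ≤ K ⊓ LinearMap.ker G.mulVecLin ⊔ T :=
  le_inf_ker_sup_of_disjoint_ker G.mulVecLin hTK hdis (by simpa [Module.finrank_fintype_fun_eq_card] using hdim)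

end Count

/-! ## §3 The injectivity socket (i) in the shape of the energy identity `⟨λ, Δ₀²λ⟩ = ‖Δ₀λ‖² = ⟨Bs λ, c⟩ = 0` -/

section Energy

variable {𝕜 : Type*} [Field 𝕜] [PartialOrder 𝕜] [StarRing 𝕜] [StarOrderedRing 𝕜]
variable {n c : Type*} [Fintype n] [Fintype c]

/-- **NO GAUGE MOTION SATISFIES an5's SLICE ROWS**, abstractly: if `Δ` is Hermitian, `Bs λ = 0` and `Δ (Δ λ)` lies in the range of `Bsᴴ`
(«`δdδ(dλ) = Δ₀²λ` is block-constant»), then `Δ λ = 0` — because `‖Δλ‖² = ⟨λ, Δ²λ⟩ = ⟨λ, Bsᴴ c⟩ = ⟨Bs λ, c⟩ = 0`. [folklore] -/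
theorem mulVec_eq_zero_of_mulVec_mulVec_eq (Δ : Matrix n n 𝕜) (hΔ : Δ.IsHermitian) (Bs : Matrix c n 𝕜) {lam : n → 𝕜}
    (hlam : Bs *ᵥ lam = 0) {e : c → 𝕜} (h : Δ *ᵥ (Δ *ᵥ lam) = Bsᴴ *ᵥ e) : Δ *ᵥ lam = 0 := by
  have key : star (Δ *ᵥ lam) ⬝ᵥ (Δ *ᵥ lam) = 0 := by
    calc star (Δ *ᵥ lam) ⬝ᵥ (Δ *ᵥ lam) = star lam ⬝ᵥ (Δᴴ *ᵥ (Δ *ᵥ lam)) := by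
            rw [star_mulVec, ← dotProduct_mulVec]
      _ = star lam ⬝ᵥ (Bsᴴ *ᵥ e) := by rw [hΔ.eq, h]
      _ = star (Bs *ᵥ lam) ⬝ᵥ e := by rw [star_mulVec, ← dotProduct_mulVec]
      _ = 0 := by rw [hlam, star_zero, zero_dotProduct]
  exact dotProduct_star_self_eq_zero.1 key

/-- Consequently such a `λ` gives the ZERO gauge motion as soon as `Δ λ = 0` forces `d λ = 0` on the class at hand (on a torus: `λ` constant;
on a Bloch fibre with non-trivial character: `λ = 0`) — packaged as: a linear `d` that kills `ker Δ ∩ ker Bs`. [folklore] -/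
theorem gaugeMotion_eq_zero {m : Type*} [Fintype m] (Δ : Matrix n n 𝕜) (hΔ : Δ.IsHermitian) (Bs : Matrix c n 𝕜) (d : Matrix m n 𝕜)
    (hker : ∀ lam : n → 𝕜, Bs *ᵥ lam = 0 → Δ *ᵥ lam = 0 → d *ᵥ lam = 0) {lam : n → 𝕜} (hlam : Bs *ᵥ lam = 0)
    {e : c → 𝕜} (h : Δ *ᵥ (Δ *ᵥ lam) = Bsᴴ *ᵥ e) : d *ᵥ lam = 0 :=
  hker lam hlam (mulVec_eq_zero_of_mulVec_mulVec_eq Δ hΔ Bs hlam h)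

end Energy

/-! ## §4 Legitimacy ⟹ the slice multiplier VANISHES on gauge-invariant sources (so `MonotoneCoarsen.isCrit_ker_of_kkt` applies to the
gauge-FREE rows directly) -/

section Multiplier

variable {𝕜 : Type*} [Field 𝕜] [PartialOrder 𝕜] [StarRing 𝕜] [StarOrderedRing 𝕜]
variable {q m n : Type*} [Fintype q] [Fintype m] [Fintype n]

/-- **THE SLICE MULTIPLIER DOES NO WORK — IT IS ZERO.**  KKT stationarity `H v − r = Qᴴ φ + Gᴴ ν` for a Hermitian form `H` killing the gauge
motions `T` (`H t = 0`: gauge invariance of the energy), hard rows `Q` killing `T` (`T` = residual gauge motions of the constraint surface), a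
`T`-INVARIANT source (`⟨t, r⟩ = 0`) and a LEGITIMATE slice in the surjective form `G(T) = ⊤` (§2) ⟹ `ν = 0`: pairing the stationarity row with
`t ∈ T` gives `⟨G t, ν⟩ = 0` for all `t`, and `G t` exhausts the row space.  Hence `H v − r = Qᴴ φ` and `v` is critical on `ker Q` by
`MonotoneCoarsen.isCrit_ker_of_kkt` — the typed (an5), block-Landau and block-axial columns all qualify on sources with block-constant divergence.
[folklore] -/
theorem sliceMultiplier_eq_zero {H : Matrix n n 𝕜} (hH : H.IsHermitian) {Q : Matrix q n 𝕜} {G : Matrix m n 𝕜}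
    {T : Submodule 𝕜 (n → 𝕜)} (hTQ : ∀ t ∈ T, Q *ᵥ t = 0) (hTH : ∀ t ∈ T, H *ᵥ t = 0) (htop : T.map G.mulVecLin = ⊤)
    {r v : n → 𝕜} {φ : q → 𝕜} {ν : m → 𝕜} (hr : ∀ t ∈ T, star t ⬝ᵥ r = 0) (hkkt : H *ᵥ v - r = Qᴴ *ᵥ φ + Gᴴ *ᵥ ν) :
    ν = 0 := by
  have key : ∀ t ∈ T, star (G *ᵥ t) ⬝ᵥ ν = 0 := by
    intro t ht
    have hHt : Hᴴ *ᵥ t = 0 := by rw [hH.eq]; exact hTH t ht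
    have e1 : star t ⬝ᵥ (H *ᵥ v) = 0 := by
      calc star t ⬝ᵥ (H *ᵥ v) = (star t ᵥ* H) ⬝ᵥ v := dotProduct_mulVec _ _ _
        _ = star (Hᴴ *ᵥ t) ⬝ᵥ v := by rw [star_mulVec, conjTranspose_conjTranspose]
        _ = 0 := by rw [hHt, star_zero, zero_dotProduct]
    have e2 : star t ⬝ᵥ (Qᴴ *ᵥ φ) = 0 := by
      rw [dotProduct_mulVec, ← star_mulVec, hTQ t ht, star_zero, zero_dotProduct]
    have e3 : star t ⬝ᵥ (Gᴴ *ᵥ ν) = star (G *ᵥ t) ⬝ᵥ ν := by rw [dotProduct_mulVec, ← star_mulVec]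
    have e4 : star t ⬝ᵥ (H *ᵥ v - r) = star t ⬝ᵥ (Qᴴ *ᵥ φ) + star t ⬝ᵥ (Gᴴ *ᵥ ν) := by rw [hkkt, dotProduct_add]
    rw [dotProduct_sub, e1, hr t ht, sub_zero, e2, e3, zero_add] at e4
    exact e4.symm
  have hν : ν ∈ T.map G.mulVecLin := by rw [htop]; exact Submodule.mem_top
  obtain ⟨t, ht, hGt⟩ := Submodule.mem_map.1 hν
  have h0 : star ν ⬝ᵥ ν = 0 := by
    have := key t ht
    rwa [show G *ᵥ t = ν from by simpa [Matrix.mulVecLin_apply] using hGt] at this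
  exact dotProduct_star_self_eq_zero.1 h0

/-- Corollary: under the hypotheses of `sliceMultiplier_eq_zero` the column solves the gauge-FREE stationarity `H v − r = Qᴴ φ` (feed this and
`Q v = 0` to `MonotoneCoarsen.isCrit_ker_of_kkt`). [folklore] -/
theorem gaugeFree_kkt_of_legit {H : Matrix n n 𝕜} (hH : H.IsHermitian) {Q : Matrix q n 𝕜} {G : Matrix m n 𝕜}
    {T : Submodule 𝕜 (n → 𝕜)} (hTQ : ∀ t ∈ T, Q *ᵥ t = 0) (hTH : ∀ t ∈ T, H *ᵥ t = 0) (htop : T.map G.mulVecLin = ⊤)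
    {r v : n → 𝕜} {φ : q → 𝕜} {ν : m → 𝕜} (hr : ∀ t ∈ T, star t ⬝ᵥ r = 0) (hkkt : H *ᵥ v - r = Qᴴ *ᵥ φ + Gᴴ *ᵥ ν) :
    H *ᵥ v - r = Qᴴ *ᵥ φ := by
  rw [hkkt, sliceMultiplier_eq_zero hH hTQ hTH htop hr hkkt, mulVec_zero, add_zero]

end Multiplier

/-! ## §5 End-to-end for the consumer (`GAN24/MonotoneCoarsen`): the two finite checks ⟹ multiplier zero ⟹ critical on the gauge-FREE `ker Q` -/

section Consumer

open Summit.QuantumFields.BalabanUV.Beta.GAN24.MonotoneCoarsen (IsCrit isCrit_ker_of_kkt)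

variable {𝕜 : Type*} [Field 𝕜] [PartialOrder 𝕜] [StarRing 𝕜] [StarOrderedRing 𝕜]
variable {q m n : Type*} [Fintype q] [Fintype m] [Fintype n]

/-- **THE SLICE MULTIPLIER IS ZERO from the two finite checks**: KKT row `H v − r = Qᴴ φ + Gᴴ ν` (`H` Hermitian), gauge motions `T ⊆ ker Q`
killed by `H`, a `T`-invariant source, (i) `Disjoint T (ker G)` and (ii) `#G-rows ≤ dim T` ⟹ `ν = 0` (§4 with `G(T) = ⊤` from §2) — the
block-constant-divergence analogue of an5's `ResolventComposition.wM_eq_zero` ∕ p3's `gaugeMultiplier_eq_zero` (there: co-closed sources). [folklore] -/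
theorem sliceMultiplier_eq_zero_of_disjoint_ker {H : Matrix n n 𝕜} (hH : H.IsHermitian) {Q : Matrix q n 𝕜} {G : Matrix m n 𝕜}
    {r v : n → 𝕜} {φ : q → 𝕜} {ν : m → 𝕜} (hkkt : H *ᵥ v - r = Qᴴ *ᵥ φ + Gᴴ *ᵥ ν)
    {T : Submodule 𝕜 (n → 𝕜)} (hTQ : T ≤ LinearMap.ker Q.mulVecLin) (hTH : ∀ t ∈ T, H *ᵥ t = 0) (hrT : ∀ t ∈ T, star t ⬝ᵥ r = 0)
    (hdis : Disjoint T (LinearMap.ker G.mulVecLin)) (hdim : Fintype.card m ≤ Module.finrank 𝕜 T) : ν = 0 :=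
  sliceMultiplier_eq_zero hH (fun t ht => by simpa [LinearMap.mem_ker, Matrix.mulVecLin_apply] using hTQ ht) hTH
    (map_eq_top_of_disjoint_ker G.mulVecLin hdis (by simpa [Module.finrank_fintype_fun_eq_card] using hdim)) hrT hkkt

/-- **CRITICAL ON THE GAUGE-FREE CONSTRAINT SPACE FROM THE TWO FINITE CHECKS.**  Same data plus `Q v = 0` ⟹ `IsCrit H r (ker Q) v`
(`ν = 0`, then `MonotoneCoarsen.isCrit_ker_of_kkt`; equivalently `MonotoneCoarsen.isCrit_of_slice` (v1.1) with `K = ker Q`, `S = ker G`, `hKST` from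
§2 — note `G v = 0` is not even needed).  This is the form in which `pairing_eq_of_isCrit` (slice independence) and `pairing_coarsen_le` (monotone
decimated covariance) consume the typed ∕ block-Landau ∕ block-axial columns on sources with block-constant divergence. [folklore] -/
theorem isCrit_ker_of_kkt₂_of_disjoint_ker {H : Matrix n n 𝕜} (hH : H.IsHermitian) {Q : Matrix q n 𝕜} {G : Matrix m n 𝕜}
    {r v : n → 𝕜} {φ : q → 𝕜} {ν : m → 𝕜} (hQ : Q *ᵥ v = 0) (hkkt : H *ᵥ v - r = Qᴴ *ᵥ φ + Gᴴ *ᵥ ν)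
    {T : Submodule 𝕜 (n → 𝕜)} (hTQ : T ≤ LinearMap.ker Q.mulVecLin) (hTH : ∀ t ∈ T, H *ᵥ t = 0) (hrT : ∀ t ∈ T, star t ⬝ᵥ r = 0)
    (hdis : Disjoint T (LinearMap.ker G.mulVecLin)) (hdim : Fintype.card m ≤ Module.finrank 𝕜 T) :
    IsCrit H r (LinearMap.ker Q.mulVecLin) v := by
  have hν : ν = 0 := sliceMultiplier_eq_zero_of_disjoint_ker hH hkkt hTQ hTH hrT hdis hdim
  refine isCrit_ker_of_kkt hQ (lam := φ) ?_
  rw [hkkt, hν, mulVec_zero, add_zero]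

end Consumer

end Summit.QuantumFields.BalabanUV.Beta.GaugeSliceLegitimacy
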